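import Summits.QuantumAdvantage.AdviceFreeQNC0.LevelSetTransfer
import Summits.QuantumAdvantage.AdviceFreeQNC0.WeightClassSumsets
import HarnessLib

/-!
# Cell qa-qnc0 (rung F-Q1, route RingFrame, crux α, line `product`): the `D = 1` unit test of the
# level-set method — `Sketch8b.LevelSetD1` PROVED

Planner qa-qnc0-p1's TARGET §20.7(d) / `Sketch8b.LevelSetD1` (ask P6d), typed VERBATIM over the
cell topic's vocabulary (`cls` of `LDMATransfer.lean`, `near`/`far` of `LevelSetTransfer.lean`,
same bodies as `Sketch8b`) and proved:

* `levelSetD1`: for every ratio `c > 3` and scale `τ > 0`, for `L ≥ 30`, every map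
  `Γ : {0,1}^L → ({0,1}^{L'} → {0,1})` with AFFINE columns (`HasDeg (fun u => Γ u v) 1` for all
  `v`) and every class `r`: if all but `≤ 2^L/10` of the class-`r` rows are `(τ/c)`-NEAR the fail
  code `𝓕_{L'}(1)`, then NO row is `τ`-far (`far 1 Γ τ = ∅`).
* `levelSetD1_balance`: the same fact in the far-set-balance shape of `FSB` at `D = 1`:
  `(1/10)·|FAR_τ| ≤ |FAR_{τ/c} ∩ cls r|` (`κ' = 1/10`, no slack).

Proof (LIT-MEMO-12 §11 + this file): let `A = cls r ∩ NEAR_{τ/c}`; by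
`three_xor_cover_of_dense_weightClass_real` (`WeightClassSumsets.lean`: double counting with the
exact class sizes, density defect `1/10 < 1/9`) every row `x` is `a ⊕ b ⊕ e` with `a, b, e ∈ A`;
affine columns give `Γ x = Γ a ⊕ Γ b ⊕ Γ e` (`HasDeg.apply_xor3`: a degree-`≤ 1` polynomial over
`𝔽₂` is additive on triples); the fail family is affine (`isElimFail_xor3`), so the potential cost
is subadditive on triples (`distFail_xor3_le`), whence
`distFail 1 (Γ x) < 3·(τ/c)·2^{L'} < τ·2^{L'}`.

This is the `D = 1` case where the sandwich ratio `2^{D+1} − 1 = 3` of TARGET §20.9(c) is attained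
(`c > 3` is needed: at `c = 3` three near rows can sum to a far one).  WHAT THIS IS NOT: nothing on
`FSB` / `FW` / `LDRAgg` for general column degree (the crux); α untouched; no separation claim.
-/

noncomputable section

namespace Summit.QuantumAdvantage.AdviceFreeQNC0

open Finset
open Literature.Computability.MetaComplexity Literature.Computability.MetaComplexity.Smolensky

/-! ### Degree-`≤ 1` polynomials over `𝔽₂` are additive on triples -/

/-- A polynomial of degree `≤ 1` on the cube over `𝔽₂` satisfies `g(a ⊕ b ⊕ c) = g a + g b + g c`
(it is affine, and `3 ≡ 1 (mod 2)` takes care of the constant term). [folklore] -/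
theorem apply_xor3_of_mem_lowDeg_one {n : ℕ} {g : CubeFn (ZMod 2) n}
    (hg : g ∈ lowDeg (ZMod 2) n 1) (a b c : Fin n → Bool) :
    g (fun i => xor (a i) (xor (b i) (c i))) = g a + g b + g c := by
  rw [lowDeg_eq_span] at hg
  refine Submodule.span_induction ?_ ?_ ?_ ?_ hg
  · rintro _ ⟨⟨S, hS⟩, rfl⟩
    rcases Nat.le_one_iff_eq_zero_or_eq_one.1 hS with h0 | h1
    · rw [Finset.card_eq_zero] at h0
      subst h0
      simp only [mono_empty, Pi.one_apply]
      decide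
    · obtain ⟨i, rfl⟩ := Finset.card_eq_one.1 h1
      simp only [mono_apply, Finset.mem_singleton, forall_eq]
      have key : ∀ p q r : Bool, (if xor p (xor q r) = true then (1 : ZMod 2) else 0) =
          (if p = true then (1 : ZMod 2) else 0) + (if q = true then 1 else 0) +
            (if r = true then 1 else 0) := by decide
      exact key (a i) (b i) (c i)
  · simp only [Pi.zero_apply, add_zero]
  · intro f g _ _ hf hg
    simp only [Pi.add_apply, hf, hg]
    ring
  · intro r f _ hf
    simp only [Pi.smul_apply, smul_eq_mul, hf]
    ring

/-- **Affine columns are additive on triples**: if `f` has `𝔽₂`-degree `≤ 1` and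
`x = a ⊕ b ⊕ c` coordinatewise, then `f x = f a ⊕ f b ⊕ f c`. [folklore] -/
theorem HasDeg.apply_xor3 {n : ℕ} {f : (Fin n → Bool) → Bool} (hf : HasDeg f 1)
    {a b c x : Fin n → Bool} (hx : ∀ i, x i = xor (a i) (xor (b i) (c i))) :
    f x = xor (f a) (xor (f b) (f c)) := by
  have hx' : x = fun i => xor (a i) (xor (b i) (c i)) := funext hx
  have h := apply_xor3_of_mem_lowDeg_one hf a b c
  rw [← hx'] at h
  have key : ∀ p q r s : Bool, ((if s = true then (1 : ZMod 2) else 0) =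
      (if p = true then (1 : ZMod 2) else 0) + (if q = true then 1 else 0) +
        (if r = true then 1 else 0)) → s = xor p (xor q r) := by decide
  exact key _ _ _ _ h

/-! ### The potential cost is subadditive on triples -/

/-- **`dist(g₁ ⊕ g₂ ⊕ g₃, 𝓕) ≤ Σ dist(gᵢ, 𝓕)`**: the three nearest fail patterns sum to a fail
pattern (`isElimFail_xor3`), which differs from `g₁ ⊕ g₂ ⊕ g₃` only where some `gᵢ` differs from
its pattern. -/
theorem distFail_xor3_le {ℓ : ℕ} (D : ℕ) (g₁ g₂ g₃ : (Fin ℓ → Bool) → Bool) :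
    distFail D (fun v => xor (g₁ v) (xor (g₂ v) (g₃ v))) ≤
      distFail D g₁ + distFail D g₂ + distFail D g₃ := by
  obtain ⟨F₁, hF₁, e₁⟩ := exists_distFail_eq D g₁
  obtain ⟨F₂, hF₂, e₂⟩ := exists_distFail_eq D g₂
  obtain ⟨F₃, hF₃, e₃⟩ := exists_distFail_eq D g₃
  rw [← e₁, ← e₂, ← e₃]
  refine le_trans (distFail_le _ (isElimFail_xor3 hF₁ hF₂ hF₃)) ?_
  unfold hdist
  refine le_trans (card_le_card ?_) (le_trans (card_union_le _ _)
    (add_le_add (card_union_le _ _) le_rfl))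
  intro v hv
  simp only [mem_filter, mem_univ, true_and, mem_union] at hv ⊢
  by_contra hne
  simp only [not_or, not_not] at hne
  obtain ⟨⟨h1, h2⟩, h3⟩ := hne
  apply hv
  rw [h1, h2, h3]
  exact (Bool.xor_assoc _ _ _).symm

/-! ### `NEAR`/`FAR` bookkeeping -/

/-- The class-`r` rows that are not `θ`-near are the `θ`-far class-`r` rows. -/
theorem cls_sdiff_near_eq {L L' : ℕ} (D : ℕ) (Γ : (Fin L → Bool) → (Fin L' → Bool) → Bool)
    (θ : ℝ) (r : ℕ) : cls L r \ near D Γ θ = far D Γ θ ∩ cls L r := by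
  ext u
  unfold cls near far
  simp only [mem_sdiff, mem_inter, mem_filter, mem_univ, true_and, not_lt]
  exact and_comm

/-! ### `LevelSetD1` -/

/-- **The `D = 1` unit test of the level-set method** (`Sketch8b.LevelSetD1`, verbatim): for an
AFFINE-column map, if class `r` is `(τ/c)`-near on all but `2^L/10` rows with `c > 3`, then NO row
is `τ`-far (for `L ≥ 30`). -/
theorem levelSetD1 :
    ∀ c τ : ℝ, 3 < c → 0 < τ → ∃ L₀ : ℕ, ∀ L L' : ℕ, L₀ ≤ L →
      ∀ Γ : (Fin L → Bool) → (Fin L' → Bool) → Bool, (∀ v, HasDeg (fun u => Γ u v) 1) → ∀ r : ℕ,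
        (10 : ℝ) * ((cls L r \ near 1 Γ (τ / c)).card : ℝ) ≤ (2 : ℝ) ^ L → far 1 Γ τ = ∅ := by
  intro c τ hc hτ
  refine ⟨30, fun L L' hL Γ hΓ r hB => ?_⟩
  -- the dense near part of class `r`
  set A : Finset (Fin L → Bool) := cls L r ∩ near 1 Γ (τ / c) with hAdef
  have hA : A ⊆ univ.filter fun u : Fin L → Bool => Hegedus.wt u % 3 = r % 3 :=
    fun u hu => (mem_inter.1 hu).1
  have hB' : (10 : ℝ) * ((((univ.filter fun u : Fin L → Bool => Hegedus.wt u % 3 = r % 3)) \ A).card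
      : ℝ) ≤ (2 : ℝ) ^ L := by
    show (10 : ℝ) * (((cls L r) \ (cls L r ∩ near 1 Γ (τ / c))).card : ℝ) ≤ (2 : ℝ) ^ L
    rw [Finset.sdiff_inter_self_left]
    exact hB
  rw [Finset.eq_empty_iff_forall_notMem]
  intro x hx
  -- `x = a ⊕ b ⊕ e` with `a, b, e` near rows of class `r`
  obtain ⟨a, ha, b, hb, e, he, hxabe⟩ :=
    three_xor_cover_of_dense_weightClass_real hL r A hA hB' x
  have hnear : ∀ u ∈ A, (distFail 1 (Γ u) : ℝ) < τ / c * (2 : ℝ) ^ L' := by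
    intro u hu
    have h := (mem_inter.1 hu).2
    unfold near at h
    exact (mem_filter.1 h).2
  have hda := hnear a ha
  have hdb := hnear b hb
  have hde := hnear e he
  -- affine columns: `Γ x = Γ a ⊕ Γ b ⊕ Γ e`
  have hΓx : Γ x = fun v => xor (Γ a v) (xor (Γ b v) (Γ e v)) :=
    funext fun v => (hΓ v).apply_xor3 hxabe
  -- subadditivity of the potential cost
  have hsub : (distFail 1 (Γ x) : ℝ) ≤
      (distFail 1 (Γ a) : ℝ) + (distFail 1 (Γ b) : ℝ) + (distFail 1 (Γ e) : ℝ) := by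
    rw [hΓx]
    exact_mod_cast distFail_xor3_le 1 (Γ a) (Γ b) (Γ e)
  -- `x` is `τ`-far: contradiction with `3τ/c < τ`
  have hfar : τ * (2 : ℝ) ^ L' ≤ (distFail 1 (Γ x) : ℝ) := by
    unfold far at hx
    exact (mem_filter.1 hx).2
  have hc0 : 0 < c := by linarith
  have h3 : 3 * (τ / c) < τ := by
    rw [← mul_div_assoc, div_lt_iff₀ hc0]
    nlinarith
  have hpow : 0 < (2 : ℝ) ^ L' := by positivity
  have h3' : 3 * (τ / c) * (2 : ℝ) ^ L' < τ * (2 : ℝ) ^ L' := mul_lt_mul_of_pos_right h3 hpow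
  linarith

/-- **`LevelSetD1` in far-set-balance shape** (`FSB` at `D = 1` with `κ' = 1/10` and no slack):
for affine-column maps, `(1/10)·|FAR_τ| ≤ |FAR_{τ/c} ∩ cls r|` (`c > 3`, `τ > 0`, `L ≥ 30`). -/
theorem levelSetD1_balance :
    ∀ c τ : ℝ, 3 < c → 0 < τ → ∃ L₀ : ℕ, ∀ L L' : ℕ, L₀ ≤ L →
      ∀ Γ : (Fin L → Bool) → (Fin L' → Bool) → Bool, (∀ v, HasDeg (fun u => Γ u v) 1) → ∀ r : ℕ,
        (1 / 10 : ℝ) * ((far 1 Γ τ).card : ℝ) ≤ ((far 1 Γ (τ / c) ∩ cls L r).card : ℝ) := by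
  intro c τ hc hτ
  obtain ⟨L₀, hL₀⟩ := levelSetD1 c τ hc hτ
  refine ⟨L₀, fun L L' hL Γ hΓ r => ?_⟩
  by_cases hB : (10 : ℝ) * ((cls L r \ near 1 Γ (τ / c)).card : ℝ) ≤ (2 : ℝ) ^ L
  · rw [hL₀ L L' hL Γ hΓ r hB, Finset.card_empty, Nat.cast_zero, mul_zero]
    exact Nat.cast_nonneg _
  · push Not at hB
    rw [cls_sdiff_near_eq] at hB
    have hfar : ((far 1 Γ τ).card : ℝ) ≤ (2 : ℝ) ^ L := by
      have h : (far 1 Γ τ).card ≤ 2 ^ L := by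
        calc (far 1 Γ τ).card ≤ (univ : Finset (Fin L → Bool)).card := card_le_univ _
          _ = 2 ^ L := by rw [card_univ, Fintype.card_fun, Fintype.card_bool, Fintype.card_fin]
      exact_mod_cast h
    linarith

/-! ### Additive LDMA at column degree `1`, every `L'` -/

/-- **Additive LDMA for affine-column maps** (the `D = 1` case of the crux's normal form, all
`L'`; TARGET §20.7(c) notes it is not covered by the separable / atom / syndrome-rank families):
for every `ε > 0`, with `κ = ε/40`, for `L ≥ L₀(ε)`, every `L'`, every map `Γ` with columns of
`𝔽₂`-degree `≤ 1` and every class `r`,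
`κ · Σ_u distFail 1 (Γ u) ≤ Σ_{u ∈ cls r} distFail 1 (Γ u) + ε·κ·2^{L+L'}`
(error/constant ratio `ε`).  From `levelSetD1_balance` at ratio `c = 4`, scale `τ = ε`:
`Σ_{cls r} φ ≥ (ε/4)·2^{L'}·|FAR_{ε/4} ∩ cls r| ≥ (ε/40)·2^{L'}·|FAR_ε|` and
`Σ_u φ ≤ 2^{L'}·|FAR_ε| + ε·2^{L+L'}`. -/
theorem ldmaAdd_degOne :
    ∀ ε : ℝ, 0 < ε → ∃ κ : ℝ, 0 < κ ∧ ∃ L₀ : ℕ, ∀ L L' : ℕ, L₀ ≤ L →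
      ∀ Γ : (Fin L → Bool) → (Fin L' → Bool) → Bool, (∀ v, HasDeg (fun u => Γ u v) 1) → ∀ r : ℕ,
        κ * ((∑ u : Fin L → Bool, distFail 1 (Γ u) : ℕ) : ℝ) ≤
          ((∑ u ∈ cls L r, distFail 1 (Γ u) : ℕ) : ℝ) + ε * κ * (2 : ℝ) ^ (L + L') := by
  intro ε hε
  obtain ⟨L₀, hL₀⟩ := levelSetD1_balance 4 ε (by norm_num) hε
  refine ⟨ε / 40, by positivity, L₀, fun L L' hL Γ hΓ r => ?_⟩
  have hbal := hL₀ L L' hL Γ hΓ r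
  have h2L : (0 : ℝ) ≤ (2 : ℝ) ^ L := by positivity
  have h2L' : (0 : ℝ) < (2 : ℝ) ^ L' := by positivity
  -- (1) total cost ≤ |FAR_ε|·2^{L'} + ε·2^{L+L'}
  have htot : ((∑ u : Fin L → Bool, distFail 1 (Γ u) : ℕ) : ℝ) ≤
      ((far 1 Γ ε).card : ℝ) * (2 : ℝ) ^ L' + ε * (2 : ℝ) ^ (L + L') := by
    push_cast
    have hfar_eq : far 1 Γ ε =
        univ.filter fun u : Fin L → Bool => ¬ ((distFail 1 (Γ u) : ℝ) < ε * (2 : ℝ) ^ L') := by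
      unfold far
      ext u
      simp only [Finset.mem_filter, Finset.mem_univ, true_and, not_lt]
    have hsplit : ∑ u : Fin L → Bool, (distFail 1 (Γ u) : ℝ) =
        (∑ u ∈ far 1 Γ ε, (distFail 1 (Γ u) : ℝ)) + ∑ u ∈ near 1 Γ ε, (distFail 1 (Γ u) : ℝ) := by
      rw [hfar_eq, add_comm]
      unfold near
      exact (Finset.sum_filter_add_sum_filter_not _ _ _).symm
    rw [hsplit]
    have hfar : ∑ u ∈ far 1 Γ ε, (distFail 1 (Γ u) : ℝ) ≤ ((far 1 Γ ε).card : ℝ) * (2 : ℝ) ^ L' := by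
      calc ∑ u ∈ far 1 Γ ε, (distFail 1 (Γ u) : ℝ) ≤ ∑ _u ∈ far 1 Γ ε, (2 : ℝ) ^ L' :=
            Finset.sum_le_sum fun u _ => by exact_mod_cast distFail_le_pow 1 (Γ u)
        _ = ((far 1 Γ ε).card : ℝ) * (2 : ℝ) ^ L' := by rw [Finset.sum_const, nsmul_eq_mul]
    have hnear : ∑ u ∈ near 1 Γ ε, (distFail 1 (Γ u) : ℝ) ≤ ε * (2 : ℝ) ^ (L + L') := by
      calc ∑ u ∈ near 1 Γ ε, (distFail 1 (Γ u) : ℝ) ≤ ∑ _u ∈ near 1 Γ ε, ε * (2 : ℝ) ^ L' :=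
            Finset.sum_le_sum fun u hu => by
              unfold near at hu
              exact (Finset.mem_filter.1 hu).2.le
        _ = ((near 1 Γ ε).card : ℝ) * (ε * (2 : ℝ) ^ L') := by rw [Finset.sum_const, nsmul_eq_mul]
        _ ≤ (2 : ℝ) ^ L * (ε * (2 : ℝ) ^ L') := by
            refine mul_le_mul_of_nonneg_right ?_ (by positivity)
            have : (near 1 Γ ε).card ≤ 2 ^ L := by
              calc (near 1 Γ ε).card ≤ (univ : Finset (Fin L → Bool)).card :=
                    Finset.card_le_card (Finset.filter_subset _ _)
                _ = 2 ^ L := by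
                    rw [Finset.card_univ, Fintype.card_fun, Fintype.card_bool, Fintype.card_fin]
            exact_mod_cast this
        _ = ε * (2 : ℝ) ^ (L + L') := by rw [pow_add]; ring
    linarith
  -- (2) class-`r` cost ≥ (ε/4)·2^{L'}·|FAR_{ε/4} ∩ cls r|
  have hcls : ε / 4 * (2 : ℝ) ^ L' * ((far 1 Γ (ε / 4) ∩ cls L r).card : ℝ) ≤
      ((∑ u ∈ cls L r, distFail 1 (Γ u) : ℕ) : ℝ) := by
    push_cast
    calc ε / 4 * (2 : ℝ) ^ L' * ((far 1 Γ (ε / 4) ∩ cls L r).card : ℝ)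
        = ∑ _u ∈ far 1 Γ (ε / 4) ∩ cls L r, ε / 4 * (2 : ℝ) ^ L' := by
          rw [Finset.sum_const, nsmul_eq_mul]; ring
      _ ≤ ∑ u ∈ far 1 Γ (ε / 4) ∩ cls L r, (distFail 1 (Γ u) : ℝ) :=
          Finset.sum_le_sum fun u hu => by
            have hu' := (Finset.mem_inter.1 hu).1
            unfold far at hu'
            exact (Finset.mem_filter.1 hu').2
      _ ≤ ∑ u ∈ cls L r, (distFail 1 (Γ u) : ℝ) :=
          Finset.sum_le_sum_of_subset_of_nonneg Finset.inter_subset_right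
            (fun u _ _ => by positivity)
  -- (3) combine with the balance `(1/10)|FAR_ε| ≤ |FAR_{ε/4} ∩ cls r|`
  have hpow : (2 : ℝ) ^ (L + L') = (2 : ℝ) ^ L * (2 : ℝ) ^ L' := pow_add _ _ _
  rw [hpow] at htot ⊢
  have hbal' : ε / 4 * (2 : ℝ) ^ L' * ((1 / 10 : ℝ) * ((far 1 Γ ε).card : ℝ)) ≤
      ε / 4 * (2 : ℝ) ^ L' * ((far 1 Γ (ε / 4) ∩ cls L r).card : ℝ) :=
    mul_le_mul_of_nonneg_left hbal (by positivity)
  have hstep : ε / 40 * ((∑ u : Fin L → Bool, distFail 1 (Γ u) : ℕ) : ℝ) ≤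
      ε / 40 * (((far 1 Γ ε).card : ℝ) * (2 : ℝ) ^ L' + ε * ((2 : ℝ) ^ L * (2 : ℝ) ^ L')) :=
    mul_le_mul_of_nonneg_left htot (by positivity)
  have e1 : ε / 40 * (((far 1 Γ ε).card : ℝ) * (2 : ℝ) ^ L' + ε * ((2 : ℝ) ^ L * (2 : ℝ) ^ L')) =
      ε / 4 * (2 : ℝ) ^ L' * ((1 / 10 : ℝ) * ((far 1 Γ ε).card : ℝ)) +
        ε * (ε / 40) * ((2 : ℝ) ^ L * (2 : ℝ) ^ L') := by ring
  linarith [hstep, hbal', hcls, e1]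

end Summit.QuantumAdvantage.AdviceFreeQNC0

end
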